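/-
Copyright (c) 2026 the pub-hodgecm-mathlib formalisation cell (harness21).  Prover seat hodgecm-mathlib-K2Liu-p12 (g0): Track B «K2-LIT»,
#184♮ = hLiu418 = stmt-HodgeConjecture-24832; Road Φ of socket #41, organ Φ4 «unramified local coefficient» (LEAD F0P6-plan (g13) ruling «M-157k»), file U1′.
-/
import Summits.HodgeConjecture.HodgeConjecture.Theorems.K2LiuLocalLeviSupply              -- ★ F3a: `exists_leviElem`, `leviD_inv_one_add_smul`, `cay_diag_mul_cay_diag`
import Summits.HodgeConjecture.HodgeConjecture.Theorems.K2LiuLocalRingValuationBalls       -- ★ F3c-1: the ball letter of record (`mball_*`, thresholds `v_w(ϖ_w)`)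
import Summits.HodgeConjecture.HodgeConjecture.Theorems.K2LiuSiegelWeylUnipotentIwasawa     -- ★ `map_nonsing_inv_of_isUnit`; `IsIntegralAt`, `apply_mem_glInt_of_isIntegralAt`
import Literature.NumberTheory.Automorphic.GLnCongruenceSubgroups                          -- ★ `isUnit_det_and_valBound_inv`, `valuation_det_eq_one`
import Literature.NumberTheory.Automorphic.ValuedFieldValuativeRelBridge                   -- ★ `v_le_iff_valuation_le` & co.
import HarnessLib

/-!
# Crux `HLiu418`, Road Φ of socket #41, organ Φ4 — FILE U1′: THE EXPLICIT LEVI SUPPLY IN `K_v = H(𝒪_v)` AT A GOOD PLACE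

Cell `hodgecm-mathlib`, crux item hLiu418 = `stmt-HodgeConjecture-24832`, route of record `HCCMUnconditional`; squad K2 ∕ K2Liu, road `K2_Liu`,
socket #41 `sig_K2LiuSiegelEisensteinContinuation`, Road Φ, organ Φ4 = «(R-bound) + the one exact value» (ruling M-157k; census
`K2/K2Liu-p12/g0/CENSUS-PHI4-UnramifiedLocalCoefficient.K2Liu-p12-g0.md` §1 (U1′)).  THEOREMS ONLY (no `def`, no `instance`, no `notation`, no
named-fact hypothesis, no `sorry`); lane `--supports stmt-HodgeConjecture-24832` (count-neutral helper; closes no socket by itself).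

WHAT.  The two hypotheses `hsup` (Levi supply at radius `jS`) and `hinv` (inverse integrality at radius `jI`) of ★ U1
`K2LiuGoodPlaceWhittakerFarShells.setIntegral_farShell_eq_zero_of_supply`, DISCHARGED AT RADIUS `1` UNIFORMLY IN THE PLACE for the hyperspecial
group `U = K_v = H(𝒪_v)` (★ `UnitaryGroup.localInt`) at a GOOD place: `|2|_w = 1` for all `w ∣ v`, the Gram matrix `T = T₀ ⊗ 1` and `T⁻¹` integral, and
the characters `χ_w` UNRAMIFIED (trivial on units of valuation `1`).  For an integral direction `u ∈ M_n(E ⊗ F_v)` and `z ∈ 𝔭_v`: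
* `inv_one_add_smul` — `1 + ẑu` has unit determinant, `(1 + ẑu)⁻¹` is integral and `(1 + ẑu)⁻¹ − 1 ∈ ball(1)` (reduction mod `𝔪_w`, ★ `isUnit_det_and_valBound_inv`);
* `levi_supply_localInt` — the Levi element `q = m(1 + ẑu)` of ★ F3a `exists_leviElem` lies in `K_v` (its adapted matrix `R (A ⊕ D) R⁻¹` and the inverse are
  integral, ★ `apply_mem_glInt_of_isIntegralAt`), has blocks `A = 1 + ẑu`, `D⁻¹ = 1 + ẑ(T⁻¹σ(u)ᵀT)`, and its Weyl conjugate `w_Δ q w_Δ` has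
  `χ_v(det_Δ) = 1` (unramified `χ_w`, `det D_w ≡ 1 mod 𝔪_w`) and `|det_Δ|_v = 1`.
Hence in ★ U1 one may take `jS = jI = 1` at every good place, and the far-shell threshold becomes `k ≥ 4 + |d| + 2|c_ε| + 2|c₂| + 4b + 2b′` — ABSOLUTE
(`= 4 + 4b + 2b′` off the conductor of `ψ` and the primes over `2δ`), which is the `v`-uniformity the (R-bound) face of organ Φ4 needs.

## References
* [Casselman1980] W. Casselman, Compositio Math. 40 (1980), §3.   * [BruhatTits1972] F. Bruhat, J. Tits, Publ. IHÉS 41 (1972), (4.4.3).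
* [PlatonovRapinchuk1994] V. Platonov, A. Rapinchuk, Algebraic groups and number theory (1994), §5.1.
* [Shimura1997] G. Shimura, CBMS 93 (1997), §18–§19.
-/

set_option autoImplicit false
-- the mandated namespace repeats the single-problem summit's segment (`HodgeConjecture.HodgeConjecture`)
set_option linter.dupNamespace false

noncomputable section

open scoped NNReal Matrix Topology ValuativeRel
open NumberField IsDedekindDomain Matrix Set Filter
open Literature.NumberTheory.Automorphic Literature.NumberTheory.Automorphic.UnitaryGroup
open Literature.NumberTheory.GelbartRogawski1991.AdaptedBlocks
open Literature.NumberTheory.GelbartRogawski1991.UnitaryDualPair.LocalSplitting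
open Literature.NumberTheory.K2Lit.LocalSiegelDoubled
open Summit.HodgeConjecture.HodgeConjecture.Cruxes.HLiu418.K2LiuSiegelLeviWeylAlgebra
open Summit.HodgeConjecture.HodgeConjecture.Cruxes.HLiu418.K2LiuLocalLeviSupply
open Summit.HodgeConjecture.HodgeConjecture.Cruxes.HLiu418.K2LiuLocalRingValuationBalls
open Summit.HodgeConjecture.HodgeConjecture.Cruxes.HLiu418.K2LiuSiegelWeylUnipotentIwasawa
open Summit.HodgeConjecture.HodgeConjecture.Cruxes.HLiu418.K2LiuSiegelDoubledLeviMatrix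

namespace Summit.HodgeConjecture.HodgeConjecture.Cruxes.HLiu418.K2LiuGoodPlaceLeviSupply

variable (F : Type) [Field F] [NumberField F] (E : Type) [Field E] [NumberField E] [Algebra F E]
  [Algebra.IsQuadraticExtension F E] (c : E ≃ₐ[F] E)
  {δ : E} (hcδ : c δ = -δ) (hδ : δ ≠ 0) {dd : F} (hd : δ * δ = algebraMap F E dd)
  (v : HeightOneSpectrum (𝓞 F)) (n : ℕ) {T₀ : Matrix (Fin n) (Fin n) F} (hT₀ : T₀.IsSymm) (hT₀d : IsUnit T₀.det)
  {JD : Matrix (Fin (n + n)) (Fin (n + n)) E} (hJD : JD = (gramD F n T₀).map (algebraMap F E))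
  {π : v.adicCompletion F} (hπ : Valued.v π = WithZero.exp (-1 : ℤ))

/-! ## §1 Between the ball letter of record (`Valued.v`, all `w ∣ v` at once) and `ValBound`∕`IsIntegralAt` (`ValuativeRel.valuation`, one `w`) -/

omit [NumberField F] [Algebra.IsQuadraticExtension F E] in
/-- the identity matrix over `E ⊗ F_v = Π_w E_w`, evaluated at `w`, is the identity matrix over `E_w`. [folklore] -/
theorem one_apply_eval {m : Type*} [DecidableEq m] (i j : m) (w : PlacesOver E v) :
    (1 : Matrix m m (LocalRing E v)) i j w = (1 : Matrix m m (w.1.adicCompletion E)) i j := by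
  by_cases h : i = j
  · subst h; rw [Matrix.one_apply_eq, Matrix.one_apply_eq, Pi.one_apply]
  · rw [Matrix.one_apply_ne h, Matrix.one_apply_ne h, Pi.zero_apply]

include hπ in
omit [Algebra.IsQuadraticExtension F E] in
/-- the threshold `v_w(ϖ_w)` is `< 1` in the `ValuativeRel` valuation of `E_w`. [cite: CasselsFrohlichANT1967, Ch. VII §1.1] -/
theorem valuation_toPlace_uniformizer_lt_one (w : PlacesOver E v) :
    ValuativeRel.valuation (w.1.adicCompletion E) (toPlace v w π) < 1 := by
  refine (v_lt_one_iff_valuation_lt_one _).1 ((valued_toPlace_uniformizer_le F E v hπ w).trans_lt ?_)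
  rw [← WithZero.exp_zero, WithZero.exp_lt_exp]; norm_num

omit [Algebra.IsQuadraticExtension F E] in
/-- `ball(0)` (letter of record) ⇒ integral at every `w` (`IsIntegralAt`). [cite: CasselsFrohlichANT1967, Ch. II §4] -/
theorem isIntegralAt_of_mball_zero {m : Type*} {X : Matrix m m (LocalRing E v)}
    (hX : ∀ i j (w : PlacesOver E v), Valued.v (X i j w) ≤ Valued.v (toPlace v w π) ^ (0 : ℤ)) (w : PlacesOver E v) :
    IsIntegralAt F E v w X := by
  intro i j
  have h := hX i j w
  rw [zpow_zero] at h
  exact (v_le_one_iff_valuation_le_one _).1 h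

omit [Algebra.IsQuadraticExtension F E] in
/-- integral at every `w` (`ValBound 1` of the `w`-components) ⇒ `ball(0)` (letter of record). [cite: CasselsFrohlichANT1967, Ch. II §4] -/
theorem mball_zero_of_forall_valBound {m : Type*} {X : Matrix m m (LocalRing E v)}
    (hX : ∀ w : PlacesOver E v, ValBound 1 (X.map (Pi.evalRingHom (fun w' : PlacesOver E v => w'.1.adicCompletion E) w))) :
    ∀ i j (w : PlacesOver E v), Valued.v (X i j w) ≤ Valued.v (toPlace v w π) ^ (0 : ℤ) := by
  intro i j w
  rw [zpow_zero]
  exact (v_le_one_iff_valuation_le_one _).2 (hX w i j)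

omit [Algebra.IsQuadraticExtension F E] in
/-- `ball(1)` (letter of record) ⇒ the `w`-component has all entries of valuation `≤ v_w(ϖ_w)`. [cite: CasselsFrohlichANT1967, Ch. II §4] -/
theorem valBound_of_mball_one {m : Type*} {X : Matrix m m (LocalRing E v)}
    (hX : ∀ i j (w : PlacesOver E v), Valued.v (X i j w) ≤ Valued.v (toPlace v w π) ^ (1 : ℤ)) (w : PlacesOver E v) :
    ValBound (ValuativeRel.valuation (w.1.adicCompletion E) (toPlace v w π))
      (X.map (Pi.evalRingHom (fun w' : PlacesOver E v => w'.1.adicCompletion E) w)) := by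
  intro i j
  have h := hX i j w
  rw [zpow_one] at h
  exact (v_le_iff_valuation_le _ _).1 h

omit [Algebra.IsQuadraticExtension F E] in
/-- entries of valuation `≤ v_w(ϖ_w)` at every `w` ⇒ `ball(1)` (letter of record). [cite: CasselsFrohlichANT1967, Ch. II §4] -/
theorem mball_one_of_forall_valBound {m : Type*} {X : Matrix m m (LocalRing E v)}
    (hX : ∀ w : PlacesOver E v, ValBound (ValuativeRel.valuation (w.1.adicCompletion E) (toPlace v w π))
      (X.map (Pi.evalRingHom (fun w' : PlacesOver E v => w'.1.adicCompletion E) w))) :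
    ∀ i j (w : PlacesOver E v), Valued.v (X i j w) ≤ Valued.v (toPlace v w π) ^ (1 : ℤ) := by
  intro i j w
  rw [zpow_one]
  exact (v_le_iff_valuation_le _ _).2 (hX w i j)

omit [NumberField F] [Algebra F E] [Algebra.IsQuadraticExtension F E] in
/-- an element of `E_w` of valuation `1` has norm `1`. [cite: CasselsFrohlichANT1967, Ch. II §4] -/
theorem norm_eq_one_of_v_eq_one (w : HeightOneSpectrum (𝓞 E)) {x : w.adicCompletion E} (hx : Valued.v x = 1) : ‖x‖ = 1 := by
  rw [NumberField.FinitePlace.norm_def, hx, map_one, NNReal.coe_one]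

/-! ## §2 `1 + ẑu` for `u` integral and `z ∈ 𝔭_v`: unit determinant, integral inverse, inverse `≡ 1 mod 𝔭` -/

include hπ in
omit [Algebra.IsQuadraticExtension F E] in
/-- **`(1 + ẑu)⁻¹`** for `u ∈ ball(0)` and `z ∈ 𝔭_v`: `det(1 + ẑu)` is a unit of `E ⊗ F_v`, `(1 + ẑu)⁻¹ ∈ ball(0)` and `(1 + ẑu)⁻¹ − 1 ∈ ball(1)`
(reduce modulo `𝔪_w` at each `w ∣ v`: ★ `isUnit_det_and_valBound_inv`). [cite: PlatonovRapinchuk1994, §5.1] [cite: Casselman1980, §3] -/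
theorem inv_one_add_smul {u : Matrix (Fin n) (Fin n) (LocalRing E v)}
    (hu : ∀ a b (w : PlacesOver E v), Valued.v (u a b w) ≤ Valued.v (toPlace v w π) ^ (0 : ℤ))
    {z : v.adicCompletion F} (hz : z ∈ primePowBall (v.adicCompletion F) 1) :
    IsUnit (1 + toLocalRing E v z • u).det ∧
      (∀ a b (w : PlacesOver E v), Valued.v ((1 + toLocalRing E v z • u)⁻¹ a b w) ≤ Valued.v (toPlace v w π) ^ (0 : ℤ)) ∧
      (∀ a b (w : PlacesOver E v), Valued.v (((1 + toLocalRing E v z • u)⁻¹ - 1) a b w) ≤ Valued.v (toPlace v w π) ^ (1 : ℤ)) := by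
  set A : Matrix (Fin n) (Fin n) (LocalRing E v) := 1 + toLocalRing E v z • u with hA
  set ev : ∀ w : PlacesOver E v, LocalRing E v →+* w.1.adicCompletion E := fun w => Pi.evalRingHom (fun w' : PlacesOver E v => w'.1.adicCompletion E) w
    with hev
  -- `A − 1 = ẑu ∈ ball(1)`
  have hN : ∀ a b (w : PlacesOver E v), Valued.v ((A - 1) a b w) ≤ Valued.v (toPlace v w π) ^ (1 : ℤ) := by
    rw [hA, add_sub_cancel_left]
    have h := mball_smul F E v hπ hz hu
    rwa [show (1 : ℤ) + 0 = 1 by ring] at h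
  -- per place: `A_w ≡ 1 mod 𝔪_w`
  have hVB : ∀ w : PlacesOver E v, ValBound (ValuativeRel.valuation (w.1.adicCompletion E) (toPlace v w π)) (A.map (ev w) - 1) := by
    intro w a b
    have h := valBound_of_mball_one F E v hN w a b
    rw [Matrix.map_apply] at h
    rw [Matrix.sub_apply, Matrix.map_apply, ← one_apply_eval F E v a b w]
    exact h
  have hw : ∀ w : PlacesOver E v, IsUnit (A.map (ev w)).det ∧ ValBound 1 (A.map (ev w))⁻¹ ∧
      ValBound (ValuativeRel.valuation (w.1.adicCompletion E) (toPlace v w π)) ((A.map (ev w))⁻¹ - 1) := fun w =>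
    isUnit_det_and_valBound_inv (hVB w) (valuation_toPlace_uniformizer_lt_one F E v hπ w)
  -- the determinant is a unit of the product ring
  have hdet : IsUnit A.det := by
    rw [Pi.isUnit_iff]
    intro w
    have h : A.det w = (A.map (ev w)).det := by
      rw [← RingHom.mapMatrix_apply, ← RingHom.map_det]; rfl
    rw [h]; exact (hw w).1
  -- the inverse, place by place
  have hinv : ∀ w : PlacesOver E v, A⁻¹.map (ev w) = (A.map (ev w))⁻¹ := fun w => map_nonsing_inv_of_isUnit (ev w) hdet
  refine ⟨hdet, mball_zero_of_forall_valBound F E v (fun w => ?_), mball_one_of_forall_valBound F E v (fun w => ?_)⟩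
  · rw [hinv w]; exact (hw w).2.1
  · have h : (A⁻¹ - 1).map (ev w) = (A.map (ev w))⁻¹ - 1 := by
      rw [Matrix.map_sub _ (map_sub (ev w)), hinv w, Matrix.map_one _ (map_zero _) (map_one _)]
    rw [h]; exact (hw w).2.2

/-! ## §3 The Levi supply in `K_v` -/

include hcδ hδ hd hT₀ hT₀d hJD hπ in
/-- **THE LEVI SUPPLY IN `K_v = H(𝒪_v)` AT A GOOD PLACE (radius `1`, uniformly in `v`).**  Assume `|2|_w = 1` for all `w ∣ v`, `T = T₀ ⊗ 1` and `T⁻¹`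
integral, and `χ_w` trivial on elements of valuation `1`.  Then for every integral direction `u` and every `z ∈ 𝔭_v` there is `q ∈ K_v`, a LEVI
element of `P_Δ(F_v)` (`C = B = 0`) with `A = 1 + ẑu`, `D⁻¹ = 1 + ẑ·(T⁻¹σ(u)ᵀT)`, and `χ_v(det_Δ(w_Δ q w_Δ)) = 1`, `|det_Δ(w_Δ q w_Δ)|_v = 1` — i.e. the
hypothesis `hsup` of ★ U1 with `U = K_v`, `jS = 1`. [cite: Casselman1980, §3] [cite: PlatonovRapinchuk1994, §5.1] [cite: Shimura1997, §18] -/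
theorem levi_supply_localInt
    (h2 : ∀ w : PlacesOver E v, ValuativeRel.valuation (w.1.adicCompletion E) (2 : w.1.adicCompletion E) = 1)
    (hTb : ∀ i j (w : PlacesOver E v), Valued.v (gramS F E v n T₀ i j w) ≤ Valued.v (toPlace v w π) ^ (0 : ℤ))
    (hTib : ∀ i j (w : PlacesOver E v), Valued.v ((gramS F E v n T₀)⁻¹ i j w) ≤ Valued.v (toPlace v w π) ^ (0 : ℤ))
    {χv : ∀ w : PlacesOver E v, (w.1.adicCompletion E)ˣ →* ℂˣ}
    (hχ : ∀ (w : PlacesOver E v) (x : (w.1.adicCompletion E)ˣ), Valued.v (x : w.1.adicCompletion E) = 1 → χv w x = 1)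
    (u : Matrix (Fin n) (Fin n) (LocalRing E v)) (hu : ∀ a b (w : PlacesOver E v), Valued.v (u a b w) ≤ Valued.v (toPlace v w π) ^ (0 : ℤ))
    (z : v.adicCompletion F) (hz : z ∈ primePowBall (v.adicCompletion F) 1) :
    ∃ q ∈ UnitaryGroup.localInt E c (n + n) JD v,
      blkC (matA F E c v n q) = 0 ∧ blkB (matA F E c v n q) = 0 ∧ blkA (matA F E c v n q) = 1 + toLocalRing E v z • u ∧
        (blkD (matA F E c v n q))⁻¹ = 1 + toLocalRing E v z • ((gramS F E v n T₀)⁻¹ * (u.map (conjLocal E c v))ᵀ * gramS F E v n T₀) ∧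
        chiDet F E c v n χv (weylDelta F E c v n hJD * q * weylDelta F E c v n hJD) = 1 ∧
        absDetDelta F E c v n (weylDelta F E c v n hJD * q * weylDelta F E c v n hJD) = 1 := by
  classical
  have hT : IsUnit (gramS F E v n T₀).det := isUnit_det_gramS' F E v n hT₀d
  set T : Matrix (Fin n) (Fin n) (LocalRing E v) := gramS F E v n T₀ with hTdef
  set A : Matrix (Fin n) (Fin n) (LocalRing E v) := 1 + toLocalRing E v z • u with hA
  set ev : ∀ w : PlacesOver E v, LocalRing E v →+* w.1.adicCompletion E := fun w => Pi.evalRingHom (fun w' : PlacesOver E v => w'.1.adicCompletion E) w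
    with hev
  obtain ⟨hdet, hAinv0, hAinv1⟩ := inv_one_add_smul F E v n hπ hu hz
  have hA'A : A⁻¹ * A = 1 := Matrix.nonsing_inv_mul _ hdet
  have hAA' : A * A⁻¹ = 1 := Matrix.mul_nonsing_inv _ hdet
  obtain ⟨q, hC, hB, hAq, hDq, hDinv, hmatA⟩ := exists_leviElem F E c hcδ hδ hd v n hT₀ hT₀d hJD hA'A hAA'
  -- integrality of `A`, `A⁻¹`, `D = T⁻¹σ(A⁻¹)ᵀT`, `D⁻¹ = T⁻¹σ(A)ᵀT` in the letter of record
  have hA0 : ∀ a b (w : PlacesOver E v), Valued.v (A a b w) ≤ Valued.v (toPlace v w π) ^ (0 : ℤ) := by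
    have hz0 : z ∈ primePowBall (v.adicCompletion F) 0 := primePowBall_antitone (by norm_num) hz
    have h := mball_add F E v (mball_one F E v (m := Fin n) (π := π)) (mball_antitone F E v hπ (a := 0) (b := 0 + 0) (by norm_num) (mball_smul F E v hπ hz0 hu))
    rw [hA]; exact h
  have hlevi0 : ∀ X : Matrix (Fin n) (Fin n) (LocalRing E v), (∀ a b (w : PlacesOver E v), Valued.v (X a b w) ≤ Valued.v (toPlace v w π) ^ (0 : ℤ)) →
      ∀ a b (w : PlacesOver E v), Valued.v ((T⁻¹ * (X.map (conjLocal E c v))ᵀ * T) a b w) ≤ Valued.v (toPlace v w π) ^ (0 : ℤ) := by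
    intro X hX
    have h := mball_mul F E v hπ (mball_mul F E v hπ hTib (mball_conjTranspose F E c v hX)) hTb
    rwa [show (0 : ℤ) + 0 + 0 = 0 by ring] at h
  have hD0 : ∀ a b (w : PlacesOver E v), Valued.v (blkD (matA F E c v n q) a b w) ≤ Valued.v (toPlace v w π) ^ (0 : ℤ) := by
    rw [hDq]; exact hlevi0 _ hAinv0
  have hDinv0 : ∀ a b (w : PlacesOver E v), Valued.v ((blkD (matA F E c v n q))⁻¹ a b w) ≤ Valued.v (toPlace v w π) ^ (0 : ℤ) := by
    rw [hDinv]; exact hlevi0 _ hA0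
  -- `D − 1 = T⁻¹σ(A⁻¹ − 1)ᵀT ∈ ball(1)`, so `det D_w ≡ 1 mod 𝔪_w`
  have hD1 : ∀ a b (w : PlacesOver E v), Valued.v ((blkD (matA F E c v n q) - 1) a b w) ≤ Valued.v (toPlace v w π) ^ (1 : ℤ) := by
    have hsub : blkD (matA F E c v n q) - 1 = T⁻¹ * ((A⁻¹ - 1).map (conjLocal E c v))ᵀ * T := by
      rw [hDq, ← hTdef, Matrix.map_sub _ (map_sub (conjLocal E c v)), Matrix.transpose_sub, Matrix.mul_sub, Matrix.sub_mul, leviD_one hT]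
    rw [hsub]
    have h := mball_mul F E v hπ (mball_mul F E v hπ hTib (mball_conjTranspose F E c v hAinv1)) hTb
    rwa [show (0 : ℤ) + 1 + 0 = 1 by ring] at h
  have hdetD : ∀ w : PlacesOver E v, Valued.v ((blkD (matA F E c v n q)).det w) = 1 := by
    intro w
    have hVB : ValBound (ValuativeRel.valuation (w.1.adicCompletion E) (toPlace v w π)) ((blkD (matA F E c v n q)).map (ev w) - 1) := by
      intro a b
      have h := valBound_of_mball_one F E v hD1 w a b
      rw [Matrix.map_apply] at h
      rw [Matrix.sub_apply, Matrix.map_apply, ← one_apply_eval F E v a b w]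
      exact h
    have h := valuation_det_eq_one hVB (valuation_toPlace_uniformizer_lt_one F E v hπ w)
    rw [← RingHom.mapMatrix_apply, ← RingHom.map_det] at h
    exact (v_eq_one_iff_valuation_eq_one _).2 h
  -- the adapted matrices of `q` and `q⁻¹` are integral, hence `q ∈ K_v`
  have hmatAinv : matA F E c v n q⁻¹ =
      cayR (LocalRing E v) (Fin n) * Matrix.fromBlocks A⁻¹ 0 0 (blkD (matA F E c v n q))⁻¹ * cayRinv (LocalRing E v) (Fin n) := by
    obtain ⟨-, hDu⟩ := isUnit_det_blkA_blkD F E c v n hC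
    set D : Matrix (Fin n) (Fin n) (LocalRing E v) := blkD (matA F E c v n q) with hDdef
    have hmatA' : matA F E c v n q = cayR (LocalRing E v) (Fin n) * Matrix.fromBlocks A 0 0 D * cayRinv (LocalRing E v) (Fin n) := by
      rw [hmatA, ← hDq]
    have hleft : cayR (LocalRing E v) (Fin n) * Matrix.fromBlocks A⁻¹ 0 0 D⁻¹ * cayRinv (LocalRing E v) (Fin n) * matA F E c v n q = 1 := by
      rw [hmatA', cay_diag_mul_cay_diag, hA'A, Matrix.nonsing_inv_mul _ hDu, Matrix.fromBlocks_one, Matrix.mul_one, cayR_mul_cayRinv]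
    have hleft' : matA F E c v n q⁻¹ * matA F E c v n q = 1 := by rw [matA_mul, inv_mul_cancel, matA_one]
    rw [← Matrix.inv_eq_left_inv hleft, ← Matrix.inv_eq_left_inv hleft']
  have hqK : q ∈ UnitaryGroup.localInt E c (n + n) JD v := by
    rw [UnitaryGroup.mem_localInt_iff]
    intro w
    refine apply_mem_glInt_of_isIntegralAt F E c v n w q ?_ ?_
    · rw [hmatA, ← hDq]
      exact isIntegralAt_conj F E v n w (h2 w) (IsIntegralAt.fromBlocks (isIntegralAt_of_mball_zero F E v hA0 w) IsIntegralAt.zero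
        IsIntegralAt.zero (isIntegralAt_of_mball_zero F E v hD0 w))
    · rw [hmatAinv]
      exact isIntegralAt_conj F E v n w (h2 w) (IsIntegralAt.fromBlocks (isIntegralAt_of_mball_zero F E v hAinv0 w) IsIntegralAt.zero
        IsIntegralAt.zero (isIntegralAt_of_mball_zero F E v hDinv0 w))
  refine ⟨q, hqK, hC, hB, hAq, ?_, ?_, ?_⟩
  · rw [hDinv, hA]
    exact leviD_inv_one_add_smul F E c v n hT₀d z u
  · -- `χ_v(det_Δ(w_Δ q w_Δ)) = 1`: `det D_w` has valuation `1` and `χ_w` is unramified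
    unfold chiDet
    refine Finset.prod_eq_one fun w _ => ?_
    rw [detDelta_weylDelta_conj F E c v n hJD hC hB w]
    by_cases hx : IsUnit ((blkD (matA F E c v n q)).det w)
    · rw [dif_pos hx]; exact hχ w hx.unit (by rw [IsUnit.unit_spec]; exact hdetD w)
    · rw [dif_neg hx]
  · -- `|det_Δ(w_Δ q w_Δ)|_v = 1`
    unfold absDetDelta
    refine Finset.prod_eq_one fun w _ => ?_
    rw [detDelta_weylDelta_conj F E c v n hJD hC hB w]
    exact norm_eq_one_of_v_eq_one E w.1 (hdetD w)

end Summit.HodgeConjecture.HodgeConjecture.Cruxes.HLiu418.K2LiuGoodPlaceLeviSupply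

end
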